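import Literature.Geometry.DiscreteGeometry.SphericalCapVolume
import Literature.Geometry.DiscreteGeometry.SolidAngleFraction
import Literature.Geometry.DiscreteGeometry.ConeTiling
import Mathlib.Data.Set.Card
import HarnessLib

/-!
# The Voronoi ownership census — core assembly, part 1/2: tools (line `birth`, lead c5)
# (route `HullExactificationCascade`, crux `ZeroDefectDensity`, stmt-AtomisticToContinuum-12086)

From the tangent-plane windows (`stub_censusFrame`) and the two transported model areas
(`stub_censusContain`), the census: on the sphere of directions about `u`, the twelve regions
`C i = capCone (dir i) (893/1250) ∩ ⋂_{contacts j} {⟪dir j, x⟫ ≤ ⟪dir i, x⟫}` are pairwise a.e.-disjoint, so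
their ball fractions sum to `≤ 1`; second-order inclusion–exclusion (exact, all triple overlaps being
empty) bounds each from below by `(1 − 893/1250)/2 − k·16423/10⁶ + m·753/250000` (`k ≤ 4` contacts, `m`
contact pairs among them, `(k, m) = (4, ≤ 1)` excluded); since `12·(cap − 4σ₁ + 2σ₂) + σ₂ > 1`, every vertex
has exactly four contacts and exactly two contact pairs among them.

* Part A — second-order inclusion–exclusion for measures with null triple overlaps (`ccore_ie2`,
  `ccore_bonferroni2`).
* Part B (tools) — null planes, the cap fraction `357/2500`, unit directions, distinct directions,
  pair sums.  The assembly itself (`stub_censusCore`) is part 2/2 (`…CensusCore.lean`).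

Mathlib + the tree's solid-angle files only; no named facts.
-/

noncomputable section

namespace Summit.AtomisticToContinuum.Crystallization.Theorems.ZeroDefectDensityBirth

open MeasureTheory Metric Set

/-! ## Part A. Second-order inclusion–exclusion with null triple overlaps -/

section IE

variable {α : Type*} [MeasurableSpace α] (μ : Measure α) {n : ℕ} (A : Fin n → Set α)

/-- **Inclusion–exclusion, second order, exact under null triple overlaps.**  For measurable sets
`A i`, `i ∈ s ⊆ Fin n`, whose triple intersections (distinct indices in `s`) are null,
`μ (⋃_{i∈s} A i) + Σ_{i<j ∈ s} μ (A i ∩ A j) = Σ_{i∈s} μ (A i)`. [folklore] -/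
theorem ccore_ie2 (hA : ∀ i, MeasurableSet (A i)) (s : Finset (Fin n))
    (h3 : ∀ i ∈ s, ∀ j ∈ s, ∀ k ∈ s, i ≠ j → i ≠ k → j ≠ k → μ (A i ∩ A j ∩ A k) = 0) :
    μ (⋃ i ∈ s, A i) + ∑ i ∈ s, ∑ j ∈ s.filter (fun j => i < j), μ (A i ∩ A j) =
      ∑ i ∈ s, μ (A i) := by
  induction s using Finset.induction_on_max with
  | empty => simp
  | insert a s hlt ih =>
    have ha : a ∉ s := fun h => lt_irrefl a (hlt a h)
    have h3s : ∀ i ∈ s, ∀ j ∈ s, ∀ k ∈ s, i ≠ j → i ≠ k → j ≠ k → μ (A i ∩ A j ∩ A k) = 0 :=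
      fun i hi j hj k hk => h3 i (Finset.mem_insert_of_mem hi) j (Finset.mem_insert_of_mem hj) k
        (Finset.mem_insert_of_mem hk)
    have ih' := ih h3s
    -- the union over `insert a s`
    have hU : (⋃ i ∈ insert a s, A i) = (⋃ i ∈ s, A i) ∪ A a := by
      rw [Finset.set_biUnion_insert, Set.union_comm]
    -- `(⋃_s A i) ∩ A a = ⋃_s (A i ∩ A a)`, a pairwise a.e.-disjoint union
    have hIU : (⋃ i ∈ s, A i) ∩ A a = ⋃ i ∈ s, (A i ∩ A a) := by
      rw [Set.iUnion₂_inter]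
    have hmeasU : MeasurableSet (⋃ i ∈ s, A i) := Finset.measurableSet_biUnion _ fun i _ => hA i
    have hsumI : μ ((⋃ i ∈ s, A i) ∩ A a) = ∑ i ∈ s, μ (A i ∩ A a) := by
      rw [hIU]
      refine measure_biUnion_finset₀ ?_ fun i _ => ((hA i).inter (hA a)).nullMeasurableSet
      intro i hi j hj hij
      refine measure_mono_null (fun x hx => ?_) (h3 i (Finset.mem_insert_of_mem hi) j
        (Finset.mem_insert_of_mem hj) a (Finset.mem_insert_self a s) hij (ne_of_lt (hlt i hi))
        (ne_of_lt (hlt j hj)))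
      exact ⟨⟨hx.1.1, hx.2.1⟩, hx.1.2⟩
    -- `μ (U ∪ A a) + μ (U ∩ A a) = μ U + μ (A a)`
    have hadd := measure_union_add_inter (⋃ i ∈ s, A i) (hA a) (μ := μ)
    -- the pair sum over `insert a s`
    have hpairs : ∑ i ∈ insert a s, ∑ j ∈ (insert a s).filter (fun j => i < j), μ (A i ∩ A j) =
        (∑ i ∈ s, ∑ j ∈ s.filter (fun j => i < j), μ (A i ∩ A j)) + ∑ i ∈ s, μ (A i ∩ A a) := by
      rw [Finset.sum_insert ha]
      -- the `i = a` row is empty: no `j` in `insert a s` with `a < j`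
      have hrow : (insert a s).filter (fun j => a < j) = ∅ := by
        ext j
        simp only [Finset.mem_filter, Finset.mem_insert, Finset.notMem_empty, iff_false, not_and]
        rintro (rfl | hj)
        · exact lt_irrefl _
        · exact fun h => lt_asymm h (hlt j hj)
      rw [hrow, Finset.sum_empty, zero_add]
      -- for `i ∈ s`: the row over `insert a s` is the row over `s` plus the term `j = a`
      have hrows : ∀ i ∈ s, ∑ j ∈ (insert a s).filter (fun j => i < j), μ (A i ∩ A j) =
          (∑ j ∈ s.filter (fun j => i < j), μ (A i ∩ A j)) + μ (A i ∩ A a) := by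
        intro i hi
        have : (insert a s).filter (fun j => i < j) = insert a (s.filter (fun j => i < j)) := by
          rw [Finset.filter_insert, if_pos (hlt i hi)]
        rw [this, Finset.sum_insert (by simp [ha]), add_comm]
      rw [Finset.sum_congr rfl hrows, Finset.sum_add_distrib]
    rw [hU, hpairs, Finset.sum_insert ha, ← ih', ← hsumI]
    -- `μ (U ∪ A a) + (P + μ (U ∩ A a)) = μ (A a) + (μ U + P)`
    have key : μ ((⋃ i ∈ s, A i) ∪ A a) + μ ((⋃ i ∈ s, A i) ∩ A a) =
        μ (⋃ i ∈ s, A i) + μ (A a) := hadd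
    calc μ ((⋃ i ∈ s, A i) ∪ A a) +
          ((∑ i ∈ s, ∑ j ∈ s.filter (fun j => i < j), μ (A i ∩ A j)) + μ ((⋃ i ∈ s, A i) ∩ A a))
        = (μ ((⋃ i ∈ s, A i) ∪ A a) + μ ((⋃ i ∈ s, A i) ∩ A a)) +
            ∑ i ∈ s, ∑ j ∈ s.filter (fun j => i < j), μ (A i ∩ A j) := by ring
      _ = (μ (⋃ i ∈ s, A i) + μ (A a)) + ∑ i ∈ s, ∑ j ∈ s.filter (fun j => i < j), μ (A i ∩ A j) := by
            rw [key]
      _ = μ (A a) + (μ (⋃ i ∈ s, A i) + ∑ i ∈ s, ∑ j ∈ s.filter (fun j => i < j), μ (A i ∩ A j)) := by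
            ring

/-- **Bonferroni, second order, on a sub-family of pairs.**  Under null triple overlaps, for any
set `M` of pairs, `μ (⋃_{i∈s} A i) + Σ_{(i,j) ∈ M, i<j ∈ s} μ (A i ∩ A j) ≤ Σ_{i∈s} μ (A i)`. [folklore] -/
theorem ccore_bonferroni2 (hA : ∀ i, MeasurableSet (A i)) (s : Finset (Fin n))
    (h3 : ∀ i ∈ s, ∀ j ∈ s, ∀ k ∈ s, i ≠ j → i ≠ k → j ≠ k → μ (A i ∩ A j ∩ A k) = 0)
    (M : Fin n → Fin n → Prop) [DecidableRel M] :
    μ (⋃ i ∈ s, A i) + ∑ i ∈ s, ∑ j ∈ s.filter (fun j => i < j ∧ M i j), μ (A i ∩ A j) ≤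
      ∑ i ∈ s, μ (A i) := by
  rw [← ccore_ie2 μ A hA s h3]
  refine add_le_add le_rfl (Finset.sum_le_sum fun i _ => ?_)
  refine Finset.sum_le_sum_of_subset_of_nonneg (fun j hj => ?_) fun _ _ _ => bot_le
  simp only [Finset.mem_filter] at hj ⊢
  exact ⟨hj.1, hj.2.1⟩

end IE


/-! ## Part B. The census -/

section Core

open Real RealInnerProductSpace Literature.Geometry.DiscreteGeometry


/-- A hyperplane through the origin of `ℝ³` is Lebesgue-null. [folklore] -/
theorem ccore_plane_null {w : (EuclideanSpace ℝ (Fin 3))} (hw : w ≠ 0) : volume {x : (EuclideanSpace ℝ (Fin 3)) | ⟪w, x⟫ = 0} = 0 := by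
  have hsub : {x : (EuclideanSpace ℝ (Fin 3)) | ⟪w, x⟫ = 0} = ((ℝ ∙ w)ᗮ : Submodule ℝ (EuclideanSpace ℝ (Fin 3))) := by
    ext x
    simp [Submodule.mem_orthogonal_singleton_iff_inner_right]
  rw [hsub]
  refine Measure.addHaar_submodule volume _ fun htop => hw ?_
  have hmem : w ∈ (ℝ ∙ w)ᗮ := by rw [htop]; exact Submodule.mem_top
  rw [Submodule.mem_orthogonal_singleton_iff_inner_right, real_inner_self_eq_norm_sq] at hmem
  exact norm_eq_zero.1 (pow_eq_zero_iff two_ne_zero |>.1 hmem)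

/-- `capCone a c ⊆ ball 0 1`. [folklore] -/
theorem ccore_capCone_subset_ball (a : (EuclideanSpace ℝ (Fin 3))) (c : ℝ) : capCone a c ⊆ ball 0 1 :=
  Set.inter_subset_right

/-- For a set inside the unit ball, the ball fraction is `vol S / vol B`. [folklore] -/
theorem ccore_bf_eq {S : Set (EuclideanSpace ℝ (Fin 3))} (hS : S ⊆ ball 0 1) :
    ballFraction (0 : (EuclideanSpace ℝ (Fin 3))) S = (volume S).toReal / (volume (ball (0 : (EuclideanSpace ℝ (Fin 3))) 1)).toReal := by
  rw [ballFraction_eq, Set.inter_eq_right.2 hS]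

/-- **The ball fraction of the cap of parameter `893/1250` is `357/2500`.** [folklore] -/
theorem ccore_bf_capCone {a : (EuclideanSpace ℝ (Fin 3))} (ha : ‖a‖ = 1) :
    ballFraction (0 : (EuclideanSpace ℝ (Fin 3))) (capCone a (893 / 1250)) = 357 / 2500 := by
  rw [ccore_bf_eq (ccore_capCone_subset_ball a _), volume_capCone_div ha (by norm_num) (by norm_num)]
  norm_num

variable {u : (EuclideanSpace ℝ (Fin 3))} {p : Fin 12 → (EuclideanSpace ℝ (Fin 3))}

/-- Radii are positive: `‖p i - u‖ > 0`. [folklore] -/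
theorem ccore_norm_pos (hR : ∀ i : Fin 12, 1 - 1 / 4000 ≤ dist u (p i) ∧ dist u (p i) ≤ 1 + 1 / 4000)
    (i : Fin 12) : 0 < ‖p i - u‖ := by
  have h := (hR i).1
  rw [dist_comm, dist_eq_norm] at h
  linarith

/-- The directions `‖p i - u‖⁻¹ • (p i - u)` are unit vectors. [folklore] -/
theorem ccore_dir_unit (hR : ∀ i : Fin 12, 1 - 1 / 4000 ≤ dist u (p i) ∧ dist u (p i) ≤ 1 + 1 / 4000)
    (i : Fin 12) : ‖‖p i - u‖⁻¹ • (p i - u)‖ = 1 := by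
  have h := ccore_norm_pos hR i
  rw [norm_smul, norm_inv, norm_norm, inv_mul_cancel₀ h.ne']

/-- Distinct points have distinct directions (their radii differ by at most `2η < 1 − η ≤` their
distance). [folklore] -/
theorem ccore_dir_ne : ∀ {u : EuclideanSpace ℝ (Fin 3)} {p : Fin 12 → EuclideanSpace ℝ (Fin 3)}, (∀ i : Fin 12, 1 - 1 / 4000 ≤ dist u (p i) ∧ dist u (p i) ≤ 1 + 1 / 4000) → (∀ i j : Fin 12, i ≠ j → 1 - 1 / 4000 ≤ dist (p i) (p j) ∧ (dist (p i) (p j) ≤ 1 + 1 / 4000 ∨ 7 / 5 ≤ dist (p i) (p j))) → ∀ {i j : Fin 12}, i ≠ j → ‖p i - u‖⁻¹ • (p i - u) ≠ ‖p j - u‖⁻¹ • (p j - u) := by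
  intro u p hR hP i j hij h
  have hi := ccore_norm_pos hR i
  have hj := ccore_norm_pos hR j
  -- `p i - u = ‖p i - u‖ • d`, `p j - u = ‖p j - u‖ • d`
  set d := ‖p i - u‖⁻¹ • (p i - u) with hd
  have hpi : p i - u = ‖p i - u‖ • d := by
    rw [hd, smul_smul, mul_inv_cancel₀ hi.ne', one_smul]
  have hpj : p j - u = ‖p j - u‖ • d := by
    rw [h, smul_smul, mul_inv_cancel₀ hj.ne', one_smul]
  have hdiff : p i - p j = (‖p i - u‖ - ‖p j - u‖) • d := by
    rw [sub_smul, ← hpi, ← hpj]; abel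
  have hdn : ‖d‖ = 1 := ccore_dir_unit hR i
  have hdist : dist (p i) (p j) = |‖p i - u‖ - ‖p j - u‖| := by
    rw [dist_eq_norm, hdiff, norm_smul, hdn, mul_one, Real.norm_eq_abs]
  have h1 := (hP i j hij).1
  have hri := (hR i).2
  have hri' := (hR i).1
  have hrj := (hR j).2
  have hrj' := (hR j).1
  rw [dist_comm, dist_eq_norm] at hri hri' hrj hrj'
  rw [hdist] at h1
  have := abs_le.2 (⟨by linarith, by linarith⟩ : -(1 / 2000 : ℝ) ≤ ‖p i - u‖ - ‖p j - u‖ ∧ ‖p i - u‖ - ‖p j - u‖ ≤ 1 / 2000)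
  linarith


/-- Double sums over ordered pairs of a finset as a sum over the filtered product. [folklore] -/
theorem ccore_sum_pairs {β : Type*} [AddCommMonoid β] {n : ℕ} (J : Finset (Fin n))
    (P : Fin n → Fin n → Prop) [DecidableRel P] (g : Fin n → Fin n → β) :
    ∑ j ∈ J, ∑ l ∈ J.filter (fun l => P j l), g j l =
      ∑ q ∈ (J ×ˢ J).filter (fun q => P q.1 q.2), g q.1 q.2 := by
  rw [Finset.sum_filter, Finset.sum_product]
  refine Finset.sum_congr rfl fun j _ => ?_
  rw [Finset.sum_filter]

end Core

end Summit.AtomisticToContinuum.Crystallization.Theorems.ZeroDefectDensityBirth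

end
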